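import Summits.CriticalPhenomena.PercolationContinuityZ3.Theorems.PercAnnulusCrossingIICTwoPointUpper
import Summits.CriticalPhenomena.PercolationContinuityZ3.Theorems.PercAnnulusCrossingMetricToBoxRendering
import HarnessLib

/-!
# The IIC volume exponent on `ℤ^d` under (A2)□: `E_ν|C(0) ∩ Λ(n)| ≤ C · n^d · π_{p_c}(n)` (lane RSW3, p1 gen 7)

builds on p205010 (kernel theorem, internal audit signed; external expert review pending) — not used here.

Seat `prim-rsw3-p1` (gen 7).  The `ℤ^d` (conditional) companion of `PercAnnulusCrossingIICPlanarVolume.lean`: at `p_c(ℤ^d)`, `d ≥ 2`,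
under the set-to-set quasi-multiplicativity hypothesis (A2)□ at one aspect (`SetToSetQuasiMultAspectAt d p_c s L ϰ`, `2 ≤ s ≤ L`, `ϰ > 0` —
OPEN for `d = 3`, the lane's standing hypothesis; the PRINTED (A2)_ρ of Basu–Sapozhnikov implies it), for every probability measure `ν`
with Kesten's IIC limit property and every `n ≥ 1`,

  `Σ_{z ∈ Λ(n)} ν(0 ↔ z) ≤ C · n^d · π_{p_c}(n)`   (`= E_ν|C(0) ∩ Λ(n)|`, `lintegral_card_filter_openConn`).

So the incipient infinite cluster has "volume dimension" at most `d − (one-arm exponent)`.  Ingredients: the two-point upper bound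
`ν(0 ↔ z) ≤ C₁ π(⌊(‖z‖−1)/2⌋)` (`iicMeasure_real_openConn_le_criticalProbI`), the one-arm RATIO bound
`π(j) · (j/(4n))^{d−1} ≤ (2d/c) · π(n)` for `1 ≤ j ≤ n` (one-arm quasi-multiplicativity, a consequence of (A2)□, with the every-aspect annulus
window `α(j,n) ≥ (2d)⁻¹ (j/(4n))^{d−1}`), `|∂Λ(k)| ≤ 2d(3k)^{d−1}`, and the BK floor `π(n) ≥ c₁ n^{−(d−1)/2}` for the sites near the origin.
The matching LOWER bound holds on `ℤ²` (`iicMeasure_sum_openConn_asymp_Z2`); on `ℤ^d` it would need a two-point lower bound (not in the tree).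

* `oneArmProb_mul_pow_le_of_oneArmQuasiMultAt` — the ratio bound;
* `iicMeasure_real_openConn_le_pow_mul_criticalProbI` — per site: `ν(0 ↔ z) ≤ C₂ (16n/‖z‖)^{d−1} π(n)` for `7 ≤ ‖z‖ ≤ n`;
* **`iicMeasure_sum_openConn_le_criticalProbI`** — the volume bound under (A2)□; `…_of_basuSapozhnikovQM` — under the printed (A2)_ρ.

Helper file for the crux `stmt-CriticalPhenomena-4575` chain; no definitions, no sorries.
References: H. Kesten, PTRF 73 (1986), Thm. (8); D. Basu, A. Sapozhnikov, ECP 22 (2017).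
-/

noncomputable section

namespace Summit.CriticalPhenomena.PercolationContinuityZ3.Theorems.Crossing

open MeasureTheory ProbabilityTheory Filter Topology
open Literature.Probability.Percolation Literature.Probability.LatticeModels
open Literature.Probability.Percolation.DCT16 Literature.Probability.Percolation.DKT20
open Summit.CriticalPhenomena.PercolationContinuityZ3.Theorems.SurfaceTension
open scoped ENNReal ProbabilityTheory Literature.Probability.Percolation

variable {d : ℕ}

/-! ## The one-arm ratio bound under quasi-multiplicativity -/

/-- **One-arm ratio bound**: under `OneArmQuasiMultAt d p_c c` (`d ≥ 2`), for `1 ≤ j ≤ n`,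
`π_{p_c}(j) · (j/(4n))^{d−1} ≤ (2d/c) · π_{p_c}(n)` — quasi-multiplicativity `c π(j) α(j,n) ≤ π(n)` and the annulus window
`α(j,n) ≥ (2d)⁻¹ (j/(4n))^{d−1}`. [cite: Kesten1986, Thm. (8)] -/
theorem oneArmProb_mul_pow_le_of_oneArmQuasiMultAt (hd : 2 ≤ d) {c : ℝ} (hc : 0 < c) (hQM : OneArmQuasiMultAt d (criticalProbI d) c)
    {j n : ℕ} (hj : 1 ≤ j) (hjn : j ≤ n) :
    oneArmProb d (criticalProbI d) j * ((j : ℝ) / (4 * n)) ^ (d - 1) ≤ 2 * d / c * oneArmProb d (criticalProbI d) n := by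
  have hwin := Rsw3.le_real_boxCrossing_criticalProbI_of_le (d := d) hd hj hjn
  have hqm := hQM j n hj hjn
  have hπj : 0 ≤ oneArmProb d (criticalProbI d) j := measureReal_nonneg
  have hd0 : (0 : ℝ) < d := by exact_mod_cast (lt_of_lt_of_le (by norm_num : 0 < 2) hd)
  have h1 : c * oneArmProb d (criticalProbI d) j * ((2 * (d : ℝ))⁻¹ * ((j : ℝ) / (4 * n)) ^ (d - 1)) ≤ oneArmProb d (criticalProbI d) n :=
    calc c * oneArmProb d (criticalProbI d) j * ((2 * (d : ℝ))⁻¹ * ((j : ℝ) / (4 * n)) ^ (d - 1))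
        ≤ c * oneArmProb d (criticalProbI d) j * (bondPercolation (zdGraph d) (criticalProbI d)).real (boxCrossing d j n) :=
          mul_le_mul_of_nonneg_left hwin (mul_nonneg hc.le hπj)
      _ = c * (oneArmProb d (criticalProbI d) j * (bondPercolation (zdGraph d) (criticalProbI d)).real (boxCrossing d j n)) := by ring
      _ ≤ oneArmProb d (criticalProbI d) n := hqm
  have h2 := mul_le_mul_of_nonneg_left h1 (by positivity : (0 : ℝ) ≤ 2 * d / c)
  have h3 : 2 * (d : ℝ) / c * (c * oneArmProb d (criticalProbI d) j * ((2 * (d : ℝ))⁻¹ * ((j : ℝ) / (4 * n)) ^ (d - 1))) =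
      oneArmProb d (criticalProbI d) j * ((j : ℝ) / (4 * n)) ^ (d - 1) := by
    field_simp
  linarith [h2, h3]

/-! ## Per-site bound -/

/-- `|{z ∈ Λ(n) : ‖z‖ = k}| ≤ |∂Λ(k)| ≤ 2d (3k)^{d−1}` for `k ≥ 1`. [folklore] -/
theorem card_sphere_le_pow (hd : 1 ≤ d) {k : ℕ} (hk : 1 ≤ k) : ((sphere d k).card : ℝ) ≤ 2 * d * (3 * (k : ℝ)) ^ (d - 1) := by
  obtain ⟨j, rfl⟩ : ∃ j, k = j + 1 := ⟨k - 1, by omega⟩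
  have h := card_sphere_succ_le (d := d) j
  refine h.trans (mul_le_mul_of_nonneg_left (pow_le_pow_left₀ (by positivity) ?_ _) (by positivity))
  push_cast
  linarith

open Classical in
/-- **Per-site bound**: at `p_c(ℤ^d)`, `d ≥ 2`, under (A2)□: there is `C₂ > 0` such that for every finite `ν` with the IIC limit property,
every `n` and every `z ∈ Λ(n)` with `‖z‖_∞ ≥ 7`, `ν(0 ↔ z) ≤ C₂ · (16n/‖z‖)^{d−1} · π_{p_c}(n)` (two-point upper bound at scale
`m = ⌊(‖z‖−1)/2⌋`, then the ratio bound between `m` and `n`, `4n/m ≤ 16n/‖z‖`). [cite: Kesten1986, Thm. (8)] -/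
theorem iicMeasure_real_openConn_le_pow_mul_criticalProbI (hd : 2 ≤ d) {s L : ℕ} (hs : 2 ≤ s) (hsL : s ≤ L) {ϰ : ℝ} (hϰ : 0 < ϰ)
    (hA2 : SetToSetQuasiMultAspectAt d (criticalProbI d) s L ϰ) :
    ∃ C₂ : ℝ, 0 < C₂ ∧ ∀ (ν : Measure (BondConfig (Site d))) [IsFiniteMeasure ν],
      (∀ (F : Finset (Sym2 (Site d))) (E : Set (BondConfig (Site d))), MeasurableSet E → DeterminedBy E ↑F →
        Tendsto (fun n : ℕ => (bondPercolation (zdGraph d) (criticalProbI d)).real (E ∩ siteToBoundary d n) /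
          oneArmProb d (criticalProbI d) n) atTop (𝓝 (ν.real E))) →
      ∀ (n : ℕ) (z : Site d), z ∈ box d n → 7 ≤ Site.supNorm z →
        ν.real (openConn 0 z) ≤ C₂ * ((16 * (n : ℝ)) / Site.supNorm z) ^ (d - 1) * oneArmProb d (criticalProbI d) n := by
  obtain ⟨C₁, hC₁, hpt⟩ := iicMeasure_real_openConn_le_criticalProbI hd hs hsL hϰ hA2
  obtain ⟨c, hc, hQM⟩ := oneArmQuasiMultAt_of_setToSetQuasiMultAspectAt hd hs hsL hϰ hA2
  have hd0 : (0 : ℝ) < d := by exact_mod_cast (lt_of_lt_of_le (by norm_num : 0 < 2) hd)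
  refine ⟨C₁ * (2 * d / c), by positivity, fun ν _ hν n z hz hk => ?_⟩
  set k : ℕ := Site.supNorm z with hkdef
  set m : ℕ := (k - 1) / 2 with hm
  have hkn : k ≤ n := mem_box_iff_supNorm_le.1 hz
  have hm1 : 1 ≤ m := by omega
  have hmn : m ≤ n := by omega
  have hk4m : k ≤ 4 * m := by omega
  have hk0 : (0 : ℝ) < k := by exact_mod_cast (lt_of_lt_of_le (by norm_num : 0 < 7) hk)
  have hm0 : (0 : ℝ) < m := by exact_mod_cast hm1
  have hn0 : (0 : ℝ) < n := by exact_mod_cast (lt_of_lt_of_le hm1 hmn)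
  -- two-point upper bound at scale `m`
  have h1 : ν.real (openConn 0 z) ≤ C₁ * oneArmProb d (criticalProbI d) m :=
    hpt ν hν k z hk (by rw [mem_sphere])
  -- ratio bound between `m` and `n`
  have h2 := oneArmProb_mul_pow_le_of_oneArmQuasiMultAt hd hc hQM hm1 hmn
  have hu : 0 < ((m : ℝ) / (4 * n)) ^ (d - 1) := by positivity
  have h3 : oneArmProb d (criticalProbI d) m ≤ 2 * d / c * oneArmProb d (criticalProbI d) n * ((4 * (n : ℝ)) / m) ^ (d - 1) := by
    have hinv : ((m : ℝ) / (4 * n)) ^ (d - 1) * ((4 * (n : ℝ)) / m) ^ (d - 1) = 1 := by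
      rw [← mul_pow, div_mul_div_comm, mul_comm (m : ℝ), div_self (by positivity), one_pow]
    calc oneArmProb d (criticalProbI d) m
        = oneArmProb d (criticalProbI d) m * ((m : ℝ) / (4 * n)) ^ (d - 1) * ((4 * (n : ℝ)) / m) ^ (d - 1) := by
          rw [mul_assoc, hinv, mul_one]
      _ ≤ 2 * d / c * oneArmProb d (criticalProbI d) n * ((4 * (n : ℝ)) / m) ^ (d - 1) :=
          mul_le_mul_of_nonneg_right h2 (by positivity)
  -- `4n/m ≤ 16n/k`
  have h4 : ((4 * (n : ℝ)) / m) ^ (d - 1) ≤ ((16 * (n : ℝ)) / k) ^ (d - 1) := by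
    refine pow_le_pow_left₀ (by positivity) ?_ _
    rw [div_le_div_iff₀ hm0 hk0]
    have : (k : ℝ) ≤ 4 * m := by exact_mod_cast hk4m
    nlinarith
  have hπn : 0 ≤ oneArmProb d (criticalProbI d) n := measureReal_nonneg
  calc ν.real (openConn 0 z) ≤ C₁ * oneArmProb d (criticalProbI d) m := h1
    _ ≤ C₁ * (2 * d / c * oneArmProb d (criticalProbI d) n * ((4 * (n : ℝ)) / m) ^ (d - 1)) := mul_le_mul_of_nonneg_left h3 hC₁.le
    _ ≤ C₁ * (2 * d / c * oneArmProb d (criticalProbI d) n * ((16 * (n : ℝ)) / k) ^ (d - 1)) :=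
        mul_le_mul_of_nonneg_left (mul_le_mul_of_nonneg_left h4 (by positivity)) hC₁.le
    _ = C₁ * (2 * d / c) * ((16 * (n : ℝ)) / k) ^ (d - 1) * oneArmProb d (criticalProbI d) n := by ring

/-! ## The volume bound -/

open Classical in
/-- **IIC VOLUME EXPONENT UNDER (A2)□**: at `p_c(ℤ^d)`, `d ≥ 2`, under `SetToSetQuasiMultAspectAt d p_c s L ϰ` (`2 ≤ s ≤ L`, `ϰ > 0`),
there is `C > 0` such that for every probability measure `ν` with Kesten's IIC limit property and every `n ≥ 1`,
`Σ_{z ∈ Λ(n)} ν(0 ↔ z) ≤ C · n^d · π_{p_c}(n)` — i.e. `E_ν|C(0) ∩ Λ(n)| ≤ C n^d π_{p_c}(n)`.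
[cite: Kesten1986, Thm. (8)] [cite: BasuSapozhnikov2017ECP, Thm. 1.1] -/
theorem iicMeasure_sum_openConn_le_criticalProbI (hd : 2 ≤ d) {s L : ℕ} (hs : 2 ≤ s) (hsL : s ≤ L) {ϰ : ℝ} (hϰ : 0 < ϰ)
    (hA2 : SetToSetQuasiMultAspectAt d (criticalProbI d) s L ϰ) :
    ∃ C : ℝ, 0 < C ∧ ∀ (ν : Measure (BondConfig (Site d))) [IsProbabilityMeasure ν],
      (∀ (F : Finset (Sym2 (Site d))) (E : Set (BondConfig (Site d))), MeasurableSet E → DeterminedBy E ↑F →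
        Tendsto (fun n : ℕ => (bondPercolation (zdGraph d) (criticalProbI d)).real (E ∩ siteToBoundary d n) /
          oneArmProb d (criticalProbI d) n) atTop (𝓝 (ν.real E))) →
      ∀ n : ℕ, 1 ≤ n →
        ∑ z ∈ box d n, ν.real (openConn (0 : Site d) z) ≤ C * (n : ℝ) ^ d * oneArmProb d (criticalProbI d) n := by
  obtain ⟨C₂, hC₂, hsite⟩ := iicMeasure_real_openConn_le_pow_mul_criticalProbI hd hs hsL hϰ hA2
  obtain ⟨c₁, hc₁, hfloor⟩ := exists_oneArmProb_criticalProbI_lower_half (d := d) hd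
  have hd0 : (0 : ℝ) < d := by exact_mod_cast (lt_of_lt_of_le (by norm_num : 0 < 2) hd)
  have hd1 : 1 ≤ d := le_trans (by norm_num) hd
  refine ⟨(13 : ℝ) ^ d / c₁ + 2 * d * C₂ * (48 : ℝ) ^ (d - 1), by positivity, fun ν _ hν n hn => ?_⟩
  have hn0 : (0 : ℝ) < n := by exact_mod_cast hn
  have hπn : 0 ≤ oneArmProb d (criticalProbI d) n := measureReal_nonneg
  -- split `Λ(n)` into the sites with `‖z‖ ≤ 6` and those with `7 ≤ ‖z‖ ≤ n`
  set P : Site d → Prop := fun z => 7 ≤ Site.supNorm z with hP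
  have hsplit := (Finset.sum_filter_add_sum_filter_not (box d n) P fun z => ν.real (openConn (0 : Site d) z)).symm
  rw [hsplit]
  -- (i) the far sites, fibrewise over `k = ‖z‖ ∈ [7, n]`
  have hfar : ∑ z ∈ (box d n).filter P, ν.real (openConn (0 : Site d) z) ≤ 2 * d * C₂ * (48 : ℝ) ^ (d - 1) * (n : ℝ) ^ d * oneArmProb d (criticalProbI d) n := by
    have hmaps : ∀ z ∈ (box d n).filter P, Site.supNorm z ∈ Finset.Icc 7 n := by
      intro z hz
      rw [Finset.mem_filter] at hz
      exact Finset.mem_Icc.2 ⟨hz.2, mem_box_iff_supNorm_le.1 hz.1⟩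
    rw [← Finset.sum_fiberwise_of_maps_to hmaps]
    have hinner : ∀ k ∈ Finset.Icc 7 n, ∑ z ∈ ((box d n).filter P).filter (fun z => Site.supNorm z = k), ν.real (openConn (0 : Site d) z) ≤
        2 * d * C₂ * (48 : ℝ) ^ (d - 1) * (n : ℝ) ^ (d - 1) * oneArmProb d (criticalProbI d) n := by
      intro k hk
      rw [Finset.mem_Icc] at hk
      have hk0 : (0 : ℝ) < k := by exact_mod_cast (lt_of_lt_of_le (by norm_num : 0 < 7) hk.1)
      have hsub : ((box d n).filter P).filter (fun z => Site.supNorm z = k) ⊆ sphere d k := by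
        intro z hz
        simp only [Finset.mem_filter] at hz
        exact (mem_sphere).2 hz.2
      have hterm : ∀ z ∈ ((box d n).filter P).filter (fun z => Site.supNorm z = k),
          ν.real (openConn (0 : Site d) z) ≤ C₂ * ((16 * (n : ℝ)) / k) ^ (d - 1) * oneArmProb d (criticalProbI d) n := by
        intro z hz
        simp only [Finset.mem_filter] at hz
        have h := hsite ν hν n z hz.1.1 hz.1.2
        rw [hz.2] at h
        exact h
      calc ∑ z ∈ ((box d n).filter P).filter (fun z => Site.supNorm z = k), ν.real (openConn (0 : Site d) z)
          ≤ ∑ _z ∈ ((box d n).filter P).filter (fun z => Site.supNorm z = k), C₂ * ((16 * (n : ℝ)) / k) ^ (d - 1) * oneArmProb d (criticalProbI d) n :=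
            Finset.sum_le_sum hterm
        _ = ((((box d n).filter P).filter (fun z => Site.supNorm z = k)).card : ℝ) * (C₂ * ((16 * (n : ℝ)) / k) ^ (d - 1) * oneArmProb d (criticalProbI d) n) := by
            rw [Finset.sum_const, nsmul_eq_mul]
        _ ≤ 2 * d * (3 * (k : ℝ)) ^ (d - 1) * (C₂ * ((16 * (n : ℝ)) / k) ^ (d - 1) * oneArmProb d (criticalProbI d) n) := by
            refine mul_le_mul_of_nonneg_right ?_ (by positivity)
            exact le_trans (by exact_mod_cast Finset.card_le_card hsub) (card_sphere_le_pow hd1 (by omega))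
        _ = 2 * d * C₂ * ((3 * (k : ℝ)) ^ (d - 1) * ((16 * (n : ℝ)) / k) ^ (d - 1)) * oneArmProb d (criticalProbI d) n := by ring
        _ = 2 * d * C₂ * (48 : ℝ) ^ (d - 1) * (n : ℝ) ^ (d - 1) * oneArmProb d (criticalProbI d) n := by
            have hkey : (3 * (k : ℝ)) ^ (d - 1) * ((16 * (n : ℝ)) / k) ^ (d - 1) = (48 : ℝ) ^ (d - 1) * (n : ℝ) ^ (d - 1) := by
              rw [← mul_pow, ← mul_pow]
              congr 1
              field_simp
              ring
            rw [hkey]; ring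
    calc ∑ k ∈ Finset.Icc 7 n, ∑ z ∈ ((box d n).filter P).filter (fun z => Site.supNorm z = k), ν.real (openConn (0 : Site d) z)
        ≤ ∑ _k ∈ Finset.Icc 7 n, 2 * d * C₂ * (48 : ℝ) ^ (d - 1) * (n : ℝ) ^ (d - 1) * oneArmProb d (criticalProbI d) n := Finset.sum_le_sum hinner
      _ = ((Finset.Icc 7 n).card : ℝ) * (2 * d * C₂ * (48 : ℝ) ^ (d - 1) * (n : ℝ) ^ (d - 1) * oneArmProb d (criticalProbI d) n) := by
          rw [Finset.sum_const, nsmul_eq_mul]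
      _ ≤ (n : ℝ) * (2 * d * C₂ * (48 : ℝ) ^ (d - 1) * (n : ℝ) ^ (d - 1) * oneArmProb d (criticalProbI d) n) := by
          refine mul_le_mul_of_nonneg_right ?_ (by positivity)
          rw [Nat.card_Icc]
          exact_mod_cast (by omega : n + 1 - 7 ≤ n)
      _ = 2 * d * C₂ * (48 : ℝ) ^ (d - 1) * ((n : ℝ) * (n : ℝ) ^ (d - 1)) * oneArmProb d (criticalProbI d) n := by ring
      _ = 2 * d * C₂ * (48 : ℝ) ^ (d - 1) * (n : ℝ) ^ d * oneArmProb d (criticalProbI d) n := by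
          rw [← pow_succ', Nat.sub_add_cancel hd1]
  -- (ii) the near sites: at most `|Λ(6)| = 13^d ≤ (13^d/c₁) n^d π(n)` by the BK floor
  have hnear : ∑ z ∈ (box d n).filter (fun z => ¬ P z), ν.real (openConn (0 : Site d) z) ≤ (13 : ℝ) ^ d / c₁ * (n : ℝ) ^ d * oneArmProb d (criticalProbI d) n := by
    have hsub : (box d n).filter (fun z => ¬ P z) ⊆ box d 6 := by
      intro z hz
      rw [Finset.mem_filter] at hz
      exact mem_box_iff_supNorm_le.2 (by simp only [hP] at hz; omega)
    have hcard : (((box d n).filter (fun z => ¬ P z)).card : ℝ) ≤ (13 : ℝ) ^ d := by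
      have h := Finset.card_le_card hsub
      rw [card_box] at h
      exact_mod_cast h
    have hone : (13 : ℝ) ^ d ≤ (13 : ℝ) ^ d / c₁ * (n : ℝ) ^ d * oneArmProb d (criticalProbI d) n := by
      -- `c₁ ≤ n^{(d-1)/2} π(n) ≤ n^d π(n)`
      have hπ := hfloor n hn
      have hpos : 0 < (n : ℝ) ^ (((d : ℝ) - 1) / 2) := Real.rpow_pos_of_pos hn0 _
      rw [div_le_iff₀ hpos] at hπ
      have hexp : (n : ℝ) ^ (((d : ℝ) - 1) / 2) ≤ (n : ℝ) ^ d := by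
        have h1 : (1 : ℝ) ≤ n := by exact_mod_cast hn
        calc (n : ℝ) ^ (((d : ℝ) - 1) / 2) ≤ (n : ℝ) ^ (d : ℝ) :=
              Real.rpow_le_rpow_of_exponent_le h1 (by linarith [hd0])
          _ = (n : ℝ) ^ d := Real.rpow_natCast _ _
      have hc₁le : c₁ ≤ (n : ℝ) ^ d * oneArmProb d (criticalProbI d) n :=
        hπ.trans (by rw [mul_comm]; exact mul_le_mul_of_nonneg_right hexp hπn)
      rw [show (13 : ℝ) ^ d / c₁ * (n : ℝ) ^ d * oneArmProb d (criticalProbI d) n = (13 : ℝ) ^ d * (((n : ℝ) ^ d * oneArmProb d (criticalProbI d) n) / c₁) by ring]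
      rw [le_mul_iff_one_le_right (by positivity), one_le_div hc₁]
      exact hc₁le
    calc ∑ z ∈ (box d n).filter (fun z => ¬ P z), ν.real (openConn (0 : Site d) z)
        ≤ ∑ _z ∈ (box d n).filter (fun z => ¬ P z), (1 : ℝ) := Finset.sum_le_sum fun z _ => measureReal_le_one
      _ = (((box d n).filter (fun z => ¬ P z)).card : ℝ) := by rw [Finset.sum_const, nsmul_eq_mul, mul_one]
      _ ≤ (13 : ℝ) ^ d := hcard
      _ ≤ _ := hone
  calc ∑ z ∈ (box d n).filter P, ν.real (openConn (0 : Site d) z) + ∑ z ∈ (box d n).filter (fun z => ¬ P z), ν.real (openConn (0 : Site d) z)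
      ≤ 2 * d * C₂ * (48 : ℝ) ^ (d - 1) * (n : ℝ) ^ d * oneArmProb d (criticalProbI d) n +
          (13 : ℝ) ^ d / c₁ * (n : ℝ) ^ d * oneArmProb d (criticalProbI d) n := add_le_add hfar hnear
    _ = ((13 : ℝ) ^ d / c₁ + 2 * d * C₂ * (48 : ℝ) ^ (d - 1)) * (n : ℝ) ^ d * oneArmProb d (criticalProbI d) n := by ring

/-- **Under the PRINTED hypothesis (A2)_ρ of Basu–Sapozhnikov** (`BasuSapozhnikovQM (zdGraph d) 0 p_c ϰ`, `d ≥ 2`, `ϰ > 0`): the same volume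
bound `Σ_{z ∈ Λ(n)} ν(0 ↔ z) ≤ C n^d π_{p_c}(n)` for every IIC measure `ν`, `n ≥ 1`. [cite: BasuSapozhnikov2017ECP, Thm. 1.1 and §1 (A2)]
[cite: Kesten1986, Thm. (8)] -/
theorem iicMeasure_sum_openConn_le_criticalProbI_of_basuSapozhnikovQM (hd : 2 ≤ d) {ϰ : ℝ} (hϰ : 0 < ϰ)
    (hBS : BasuSapozhnikovQM (zdGraph d) (0 : Site d) (criticalProbI d) ϰ) :
    ∃ C : ℝ, 0 < C ∧ ∀ (ν : Measure (BondConfig (Site d))) [IsProbabilityMeasure ν],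
      (∀ (F : Finset (Sym2 (Site d))) (E : Set (BondConfig (Site d))), MeasurableSet E → DeterminedBy E ↑F →
        Tendsto (fun n : ℕ => (bondPercolation (zdGraph d) (criticalProbI d)).real (E ∩ siteToBoundary d n) /
          oneArmProb d (criticalProbI d) n) atTop (𝓝 (ν.real E))) →
      ∀ n : ℕ, 1 ≤ n →
        ∑ z ∈ box d n, ν.real (openConn (0 : Site d) z) ≤ C * (n : ℝ) ^ d * oneArmProb d (criticalProbI d) n :=
  iicMeasure_sum_openConn_le_criticalProbI hd (s := 4 * d) (L := 4 * d * (4 * d)) (by omega)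
    (Nat.le_mul_of_pos_right _ (by omega)) (by positivity)
    (setToSetQuasiMultAspectAt_of_basuSapozhnikovQM hd hϰ.le hBS)

end Summit.CriticalPhenomena.PercolationContinuityZ3.Theorems.Crossing

end
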